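import Literature.Probability.RandomPlanarGeometry.LoewnerThrPieces
import HarnessLib

/-!
# The remaining hull takes finitely many values while the curve avoids the hull

Topic `Probability/RandomPlanarGeometry`; theorems only (crux `stmt-CriticalPhenomena-0698`, stub
`stub_isLocal`, through-swallow image chain of the locality of SLE₆: G. F. Lawler (2005), §6.3
Thm. 6.13, "the finitely many instants at which the hull swallows pieces of `A`";
Lawler–Schramm–Werner (2003), §5). For a chordal Loewner chain generated by a curve `γ` and a `*`-hull
`A`, on a horizon `[0, β]` on which `γ` avoids `A` and the remaining hull `A ∖ K̂_t = remHull W A t`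
is closed, **the remaining hull takes finitely many values** (`finite_image_remHull`), by a packing
argument: `γ[0, β]` and `A` are disjoint compact sets, at distance `≥ d > 0`; whenever the remaining
hull differs at `s < t`, the clopen piece `A_s^rem ∖ A_t^rem` of `A` has a point `p ∈ ℍ` swallowed in
`(s, t]`, and the half-ball `B(p, d) ∩ ℍ` — connected and missed by `γ[0, t]` — lies in one component
of `ℍ ∖ γ[0, ·]` at both times (`IsGeneratedByCurve.mem_hull_iff`), so the ball `B(p + i d/2, d/2)`
lies in `K_t ∖ K_s` (`exists_ball_subset_hull_sdiff`). Along a chain of `N + 1` distinct values these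
balls are pairwise disjoint with centres `d`-apart in the compact `d`-thickening of `A`, whence
`N` is bounded by a covering number.
-/

noncomputable section

open Set Filter Topology Function Complex Metric
open UpperHalfPlane (upperHalfPlaneSet)
open scoped NNReal

namespace Literature.Probability.RandomPlanarGeometry

namespace Loewner

variable {W : ℝ≥0 → ℝ} {A : Set ℂ} {γ : ℝ≥0 → ℂ}

/-! ### Connected sets missed by the curve are swallowed whole or not at all -/

/-- **A preconnected subset of `ℍ` missed by `γ[0, t]` lies in the hull `K_t` or misses it**, according
to any one of its points (its points share their component of `ℍ ∖ γ[0, t]`, `IsGeneratedByCurve.mem_hull_iff`).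
[cite: Lawler2005, Ch. 4 §4.1] -/
theorem IsGeneratedByCurve.subset_hull_or_disjoint_of_isPreconnected (hγ : IsGeneratedByCurve W γ)
    {t : ℝ≥0} {D : Set ℂ} (hD : IsPreconnected D) (hDH : D ⊆ upperHalfPlaneSet)
    (hDγ : Disjoint D (γ '' Icc 0 t)) {p : ℂ} (hp : p ∈ D) :
    (p ∈ hull W t → D ⊆ hull W t) ∧ (p ∉ hull W t → Disjoint D (hull W t)) := by
  set F := upperHalfPlaneSet \ γ '' Icc 0 t with hF
  have hDF : D ⊆ F := fun z hz ↦ ⟨hDH hz, Set.disjoint_left.1 hDγ hz⟩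
  have hcomp : ∀ z ∈ D, connectedComponentIn F z = connectedComponentIn F p := fun z hz ↦
    (connectedComponentIn_eq (hD.subset_connectedComponentIn hp hDF hz)).symm
  have hiff : ∀ z ∈ D, (z ∈ hull W t ↔ p ∈ hull W t) := fun z hz ↦ by
    rw [hγ.mem_hull_iff (hDH hz) (hDF hz).2, hγ.mem_hull_iff (hDH hp) (hDF hp).2, hcomp z hz]
  exact ⟨fun hpK z hz ↦ (hiff z hz).2 hpK,
    fun hpK ↦ Set.disjoint_left.2 fun z hz hzK ↦ hpK ((hiff z hz).1 hzK)⟩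

/-! ### A ball in `K_t ∖ K_s` for every change of the remaining hull -/

/-- **Every change of the (closed) remaining hull between `s < t` produces a ball of radius `d/2` in
`K_t ∖ K_s` centred within `d` of `A`**, when `γ[0, t]` stays `d`-far from `A`: the clopen piece
`A_s^rem ∖ A_t^rem` of `A` has a point `p ∈ ℍ` (`IsStarHull.closure_piece_inter`) swallowed in `(s, t]`,
and the half-ball `B(p, d) ∩ ℍ ⊇ B(p + i d/2, d/2)` follows `p`
(`subset_hull_or_disjoint_of_isPreconnected`). [cite: Lawler2005, §6.3 Thm. 6.13] -/
theorem exists_ball_subset_hull_sdiff (hγ : IsGeneratedByCurve W γ) (hW : Continuous W)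
    (hA : IsStarHull A) {d : ℝ} (hd : 0 < d) {s t : ℝ≥0}
    (hfar : ∀ x ∈ γ '' Icc 0 t, ∀ a ∈ A, d ≤ dist x a)
    (hcls : IsClosed (remHull W A s)) (hclt : IsClosed (remHull W A t))
    (hsub : remHull W A t ⊆ remHull W A s) (hne : remHull W A s ≠ remHull W A t) :
    ∃ c : ℂ, c ∈ cthickening d A ∧ ball c (d / 2) ⊆ hull W t ∧ Disjoint (ball c (d / 2)) (hull W s) := by
  -- the clopen piece `S = A_s^rem ∖ A_t^rem`
  set S := remHull W A s \ remHull W A t with hSdef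
  have hSA : S ⊆ A := fun z hz ↦ remHull_subset W A s hz.1
  have hS : IsClosed S := by
    have : S = remHull W A s ∩ closedHull W t := by
      ext z
      constructor
      · rintro ⟨hzs, hzt⟩
        refine ⟨hzs, ?_⟩
        by_contra h
        exact hzt ⟨remHull_subset W A s hzs, h⟩
      · rintro ⟨hzs, hzK⟩
        exact ⟨hzs, fun h ↦ h.2 hzK⟩
    rw [this]; exact hcls.inter (isClosed_closedHull hW t)
  have hS' : IsClosed (A \ S) := by
    have : A \ S = (A \ remHull W A s) ∪ remHull W A t := by
      ext z
      constructor
      · rintro ⟨hzA, hzS⟩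
        by_cases hzs : z ∈ remHull W A s
        · right; by_contra hzt; exact hzS ⟨hzs, hzt⟩
        · left; exact ⟨hzA, hzs⟩
      · rintro (⟨hzA, hzs⟩ | hzt)
        · exact ⟨hzA, fun h ↦ hzs h.1⟩
        · exact ⟨remHull_subset W A t hzt, fun h ↦ h.2 hzt⟩
    rw [this]; exact (isClosed_diff_remHull hW hA s).union hclt
  have hSne : S.Nonempty := by
    obtain ⟨a, ha, hat⟩ := Set.exists_of_ssubset (hsub.ssubset_of_ne (Ne.symm hne))
    exact ⟨a, ha, hat⟩
  -- a point of the piece in `ℍ`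
  obtain ⟨p, hpS, hpH⟩ : (S ∩ upperHalfPlaneSet).Nonempty := by
    by_contra h
    rw [not_nonempty_iff_eq_empty] at h
    have hcl := hA.closure_piece_inter hSA hS hS'
    rw [h, closure_empty] at hcl
    exact hSne.ne_empty hcl.symm
  have hpA : p ∈ A := hSA hpS
  have hpim : 0 < p.im := hpH
  have hps : p ∉ hull W s := fun h ↦ hpS.1.2 (hull_subset_closedHull W s h)
  have hpt : p ∈ hull W t := by
    have hpK : p ∈ closedHull W t := by
      by_contra h; exact hpS.2 ⟨hpA, h⟩
    rcases mem_closedHull_iff.1 hpK with h | h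
    · exact h
    · exact absurd h.1 hpim.ne'
  -- the half-ball `D = B(p, d) ∩ ℍ`
  set D := ball p d ∩ upperHalfPlaneSet with hDdef
  have hDconv : Convex ℝ D := (convex_ball p d).inter (convex_halfSpace_im_gt 0)
  have hDγ : ∀ r ≤ t, Disjoint D (γ '' Icc 0 r) := fun r hr ↦ by
    refine Set.disjoint_left.2 fun z hz hzγ ↦ ?_
    obtain ⟨u, hu, rfl⟩ := hzγ
    have h1 := hfar (γ u) ⟨u, ⟨hu.1, hu.2.trans hr⟩, rfl⟩ p hpA
    have h2 : dist (γ u) p < d := hz.1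
    linarith
  have hpD : p ∈ D := ⟨mem_ball_self hd, hpH⟩
  have hsub_t : D ⊆ hull W t :=
    (hγ.subset_hull_or_disjoint_of_isPreconnected hDconv.isPreconnected inter_subset_right (hDγ t le_rfl) hpD).1 hpt
  have hdisj_s : Disjoint D (hull W s) := by
    rcases le_or_gt s t with hst | hts
    · exact (hγ.subset_hull_or_disjoint_of_isPreconnected hDconv.isPreconnected inter_subset_right
        (hDγ s hst) hpD).2 hps
    · exact absurd (hull_mono W hts.le hpt) hps
  -- the ball `B(p + i d/2, d/2) ⊆ D`
  set c : ℂ := p + ((d / 2 : ℝ) : ℂ) * I with hcdef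
  have hcp : dist c p = d / 2 := by
    rw [dist_eq_norm, hcdef, add_sub_cancel_left, norm_mul, norm_real, norm_I, mul_one,
      Real.norm_of_nonneg (by positivity)]
  have hball : ball c (d / 2) ⊆ D := fun w hw ↦ by
    have hw' : dist w c < d / 2 := hw
    refine ⟨?_, ?_⟩
    · show dist w p < d
      calc dist w p ≤ dist w c + dist c p := dist_triangle _ _ _
        _ < d / 2 + d / 2 := by rw [hcp]; linarith
        _ = d := by ring
    · show 0 < w.im
      have h1 : |(w - c).im| ≤ ‖w - c‖ := abs_im_le_norm _
      rw [← dist_eq_norm] at h1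
      have h2 : c.im = p.im + d / 2 := by simp [hcdef]
      have h3 := (abs_le.1 h1).1
      rw [sub_im] at h3
      linarith
  refine ⟨c, mem_cthickening_of_dist_le c p d A hpA (by rw [hcp]; linarith), hball.trans hsub_t,
    hdisj_s.mono_left hball⟩

/-- **Disjoint balls of radius `d/2` have centres at distance `≥ d`** (the midpoint would lie in both).
[folklore] -/
theorem le_dist_of_disjoint_ball {c c' : ℂ} {d : ℝ} (h : Disjoint (ball c (d / 2)) (ball c' (d / 2))) :
    d ≤ dist c c' := by
  by_contra hlt
  rw [not_le] at hlt
  set m : ℂ := midpoint ℝ c c' with hm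
  have h1 : dist m c < d / 2 := by
    rw [dist_comm, hm, dist_left_midpoint, Real.norm_ofNat]; linarith
  have h2 : dist m c' < d / 2 := by
    rw [dist_comm, hm, dist_right_midpoint, Real.norm_ofNat]; linarith
  exact Set.disjoint_left.1 h (mem_ball.2 h1) (mem_ball.2 h2)

/-! ### Finiteness -/

/-- **While the curve avoids the hull, the closed remaining hulls take finitely many values.** For a
chain generated by `γ` (continuous driving function), a `*`-hull `A` and a horizon `[0, β]` on which
`γ` avoids `A` and every `A ∖ K̂_t` is closed, `remHull W A '' [0, β]` is finite (packing: a chain of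
`M + 2` values would give `M + 1` pairwise disjoint balls of radius `d/2` centred in the compact
`d`-thickening of `A`, two of them in one ball of radius `d/4` of a finite cover of size `M`).
[cite: Lawler2005, §6.3 Thm. 6.13 (finitely many swallowing instants)] -/
theorem finite_image_remHull (hγ : IsGeneratedByCurve W γ) (hW : Continuous W) (hA : IsStarHull A)
    {β : ℝ≥0} (hcl : ∀ t ≤ β, IsClosed (remHull W A t)) (hγA : ∀ t ≤ β, γ t ∉ A) :
    (remHull W A '' Icc 0 β).Finite := by
  -- separation `d` between `γ[0, β]` and `A`
  have hK : IsCompact (γ '' Icc 0 β) := isCompact_Icc.image hγ.continuous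
  have hdisj : Disjoint (γ '' Icc 0 β) A := by
    refine Set.disjoint_left.2 ?_
    rintro _ ⟨r, hr, rfl⟩ h
    exact hγA r hr.2 h
  obtain ⟨d, hd, hdd⟩ := hdisj.exists_thickenings hK hA.isBoundedHull.isClosed
  have hsep : ∀ x ∈ γ '' Icc 0 β, ∀ a ∈ A, d ≤ dist x a := fun x hx a ha ↦ by
    by_contra h
    exact Set.disjoint_left.1 hdd (self_subset_thickening hd _ hx) (mem_thickening_iff.2 ⟨a, ha, not_le.1 h⟩)
  -- a finite `d/4`-net of the compact `d`-thickening of `A`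
  obtain ⟨N, -, hNfin, hcover⟩ :=
    finite_cover_balls_of_compact (hA.isBoundedHull.isCompact.cthickening (r := d)) (e := d / 4) (by positivity)
  obtain ⟨Nf, hNf⟩ := hNfin.exists_finset_coe
  set M := Nf.card with hM
  by_contra hinf
  -- a chain of `M + 2` values, read at increasing times
  obtain ⟨F, hFsub, hFcard⟩ := Set.Infinite.exists_subset_card_eq hinf (M + 2)
  have hex : ∀ v ∈ F, ∃ τ : ℝ≥0, τ ∈ Icc 0 β ∧ remHull W A τ = v := fun v hv ↦ hFsub hv
  choose! τ hτI hτv using hex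
  have hinj : Set.InjOn τ ↑F := fun v hv w hw h ↦ by rw [← hτv v hv, ← hτv w hw, h]
  set T : Finset ℝ≥0 := F.image τ with hT
  have hTcard : T.card = M + 2 := by rw [hT, Finset.card_image_of_injOn hinj, hFcard]
  set e := T.orderEmbOfFin hTcard with he
  have he_spec : ∀ i, ∃ v ∈ F, τ v = e i := fun i ↦
    Finset.mem_image.1 (Finset.orderEmbOfFin_mem T hTcard i)
  have heI : ∀ i, e i ≤ β := fun i ↦ by
    obtain ⟨v, hv, hve⟩ := he_spec i
    rw [← hve]; exact (hτI v hv).2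
  have hval : ∀ i j, i ≠ j → remHull W A (e i) ≠ remHull W A (e j) := fun i j hij h ↦ by
    obtain ⟨v, hv, hve⟩ := he_spec i
    obtain ⟨w, hw, hwe⟩ := he_spec j
    rw [← hve, ← hwe, hτv v hv, hτv w hw] at h
    apply hij
    apply e.injective
    rw [← hve, ← hwe, h]
  -- a ball in `K_{t_{k+1}} ∖ K_{t_k}` for each consecutive pair
  have hballs : ∀ k : Fin (M + 1), ∃ c : ℂ, c ∈ cthickening d A ∧
      ball c (d / 2) ⊆ hull W (e k.succ) ∧ Disjoint (ball c (d / 2)) (hull W (e k.castSucc)) := by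
    intro k
    have hk : k.castSucc < k.succ := Fin.castSucc_lt_succ
    have hlt : e k.castSucc < e k.succ := e.strictMono hk
    refine exists_ball_subset_hull_sdiff hγ hW hA hd (fun x hx a ha ↦ hsep x ?_ a ha)
      (hcl _ (heI _)) (hcl _ (heI _)) (remHull_anti W A hlt.le)
      (hval _ _ fun h ↦ hk.ne h)
    obtain ⟨u, hu, rfl⟩ := hx
    exact ⟨u, ⟨hu.1, hu.2.trans (heI _)⟩, rfl⟩
  choose c hcA hcin hcout using hballs
  -- the centres are pairwise `d`-apart
  have hfar : ∀ i j : Fin (M + 1), i < j → d ≤ dist (c i) (c j) := by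
    intro i j hij
    refine le_dist_of_disjoint_ball (Set.disjoint_left.2 fun w hwi hwj ↦ ?_)
    have hle : e i.succ ≤ e j.castSucc := e.monotone (by
      rw [Fin.le_iff_val_le_val, Fin.val_succ, Fin.val_castSucc]; exact hij)
    exact Set.disjoint_left.1 (hcout j) hwj (hull_mono W hle (hcin i hwi))
  -- two centres in one ball of the net: contradiction
  have hnet : ∀ k : Fin (M + 1), ∃ n ∈ Nf, c k ∈ ball n (d / 4) := fun k ↦ by
    have := hcover (hcA k)
    rw [mem_iUnion₂] at this
    obtain ⟨n, hn, hk⟩ := this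
    exact ⟨n, by rw [← Finset.mem_coe, hNf]; exact hn, hk⟩
  choose n hnN hcn using hnet
  have hmaps : Set.MapsTo n ↑(Finset.univ : Finset (Fin (M + 1))) ↑Nf := fun k _ ↦ hnN k
  have hcard : Nf.card < (Finset.univ : Finset (Fin (M + 1))).card := by
    rw [Finset.card_univ, Fintype.card_fin]; exact Nat.lt_succ_self M
  obtain ⟨i, -, j, -, hij, hnij⟩ := Finset.exists_ne_map_eq_of_card_lt_of_maps_to hcard hmaps
  have hdist : dist (c i) (c j) < d / 2 := by
    calc dist (c i) (c j) ≤ dist (c i) (n i) + dist (n i) (c j) := dist_triangle _ _ _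
      _ < d / 4 + d / 4 := by
          gcongr
          · exact hcn i
          · rw [dist_comm, hnij]; exact hcn j
      _ = d / 2 := by ring
  rcases lt_or_gt_of_ne hij with h | h
  · have := hfar i j h; linarith
  · have := hfar j i h; rw [dist_comm] at this; linarith

end Loewner

end Literature.Probability.RandomPlanarGeometry

end
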